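import Mathlib
import Summits.ValiantsHypothesis.ValiantsHypothesis.Theorems.NewtonUnitEquationsDissociatedUniformTotalsLawUnion
import Summits.ValiantsHypothesis.ValiantsHypothesis.Theorems.NewtonUnitEquationsDissociatedUniformTotalsLawUnionEPRS
import Summits.ValiantsHypothesis.ValiantsHypothesis.Theorems.NewtonUnitEquationsDissociatedUniformTotalsLawUnionVertLowerCluster
import Summits.ValiantsHypothesis.ValiantsHypothesis.Theorems.NewtonUnitEquationsDissociatedUniformTotalsLawUnionVertLower
import HarnessLib

/-!
# Crux `NewtonUnitEquations.DissociatedUniform` (stmt-ValiantsHypothesis-5905): the POINTWISE union vertex count is `Θ(|G|^{4/3})` — settled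

One-stop record of the pointwise theory of the union of fibres `U_s(Z) = ⋃_{z∈Z} P_{s-z} ⊆ A + B` (`unionVert a b Z s =
#vert conv U_s(Z)`), now CLOSED up to constants:
* UPPER (Eisenbrand–Pach–Rothvoß–Sopher, tree `…TotalsLawUnionEPRS.unionVert_pow_three_le`): `unionVert³ ≤ 110592·|G|⁴` for every
  finite abelian `G`, all `a b`, `Z`, `s` (`unionVert ≤ 48|G|^{4/3}`);
* LOWER (this seat, `…TotalsLawUnionVertLower`): for every `m ≥ 1` the projective-grid family `UVBCex` on `G = ℤ/2m × ℤ/8m²`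
  (`|G| = 16m³`, unbounded) has `|G|⁴ ≤ 1024·unionVert³` (`unionVert ≥ 4m⁴ ≥ |G|^{4/3}/10.08`).
So `max unionVert = Θ(|G|^{4/3})`: the fibre structure of a pair sumset buys NOTHING pointwise over general convexly independent
subsets of a Minkowski sum, and the located rung `UnionVertBound C` (`≤ C|G|`) is false for every `C` (`not_unionVertBound`).  What
survives is the AVERAGED theory: `AverageUnionBound 1584000` (PROVED, `…AverageUnionBound`), `UnionTotalsLaw C` (sum over the `|G|`
classes; OPEN, located `C = 2`; the lower-bound family has union totals `≈ 1.02|G|²`), `FibreLevelBound` (OPEN), and on the convexly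
ordered stratum `ConvexUnionVertBound` (OPEN; there Tiwary 2014 / Skomra–Thomassé 2021 put convex subsets of `P + Q` at `Θ(q log q)`).
Honest label: summary theorem (both halves already in the tree); `TotalsLawThree`, `UnionTotalsLaw` remain OPEN; nothing here bears
on VP ≠ VNP.
[folklore: combination of the two tree results]
-/

set_option linter.dupNamespace false -- `ValiantsHypothesis.ValiantsHypothesis` (summit = problem) in every name

namespace Summit.ValiantsHypothesis.ValiantsHypothesis.Theorems.NewtonUnitEquationsDissociatedUniform

namespace TotalsLaw

/-- **The pointwise union vertex count is `Θ(|G|^{4/3})`.**  Upper half: `unionVert³ ≤ 48³·|G|⁴` always (EPRS).  Lower half: for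
every `N` there is a configuration with `|G| ≥ N` and `|G|⁴ ≤ 1024·unionVert³` (the family `UVBCex` at `m = N`, `|G| = 16N³`).
[cite: EisenbrandEtAl2008, Theorem 1] -/
theorem unionVert_pointwise_order :
    (∀ (G : Type) [AddCommGroup G] [Fintype G] (a b : G → (Fin 2 → ℝ)) (Z : Set G) (s : G),
        unionVert a b Z s ^ 3 ≤ 110592 * Fintype.card G ^ 4) ∧
      ∀ N : ℕ, ∃ (G : Type) (_ : AddCommGroup G) (_ : Fintype G) (a b : G → (Fin 2 → ℝ)) (Z : Set G) (s : G),
        N ≤ Fintype.card G ∧ Fintype.card G ^ 4 ≤ 1024 * unionVert a b Z s ^ 3 := by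
  refine ⟨fun G _ _ a b Z s => unionVert_pow_three_le a b Z s, fun N => ?_⟩
  haveI : NeZero (N + 1) := ⟨Nat.succ_ne_zero N⟩
  refine ⟨UVBCex.Grp (N + 1), inferInstance, inferInstance, UVBCex.aC (N + 1), UVBCex.bC (N + 1), UVBCex.Zset (N + 1), 0,
    ?_, UVBCex.card_pow_four_le_unionVert_cube (N + 1)⟩
  rw [UVBCex.card_Grp]
  have h1 : N + 1 ≤ (N + 1) ^ 3 := Nat.le_self_pow (by norm_num) (N + 1)
  linarith

end TotalsLaw

end Summit.ValiantsHypothesis.ValiantsHypothesis.Theorems.NewtonUnitEquationsDissociatedUniform
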